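import Summits.AtomisticToContinuum.Crystallization.Theorems.ChargedEnergyGapConeTail
import HarnessLib

/-!
# Charged energy gap — lens-3 g64, node «BarlowRef» (R3) — part 18 (addendum; imports part 16): the PER-SOURCE KERNEL of the tube regime as ONE theorem

The first half of the per-band certificate recipe (HANDOFF g65, item 2) packaged: for ONE source `y` at distance `a := dist y c > r` from the
carrier (TUBE REGIME), the axis `b 2 = (c − y)/a`, every finite set `T` of sites of a Barlow image, any `κ ≥ 0` with `r² ≤ κ²(a² − r²)`
(a rational upper bound of the shadow-cone slope `r/√(a² − r²)`), any increasing cut points `0 < α₀ ≤ α₁ ≤ … ≤ α_K`, `α_K ≥ 18/5`, such that every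
target SEEN THROUGH THE TUBE has axial coordinate `≥ α₀` (hypothesis `hstart`, discharged by the START LEMMAS below) and distance `≥ d₀` from `y`:

  ★★ `source_kernel_mul_le` :
  `(Σ_{z ∈ T} [y ≠ z ∧ infDist c [y,z] ≤ r] (dist y z)⁻⁶) · (a·(a√3/2)·h)`
  `  ≤ Σ_{k<K} coneVol κ ((κ+1)·9/5) (α_k − 9/5) (α_{k+1} + 9/5) · (max α_k d₀)⁻⁶  +  (128π/7) κ²/α_K³ + (128π/31) ((2κ+1)·9/5)²/α_K⁵`.

START LEMMAS (what makes the certificate sharp — the first classes carry the weight): for a target `z` seen through the tube,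
* `start_le_axial` — pair separation: `b₀ ≤ dist y z`, `α₀² a² ≤ (a² − r²) b₀²` ⟹ `α₀ ≤ τ_z` (`τ_z := ⟪b 2, z − y⟫`);
* ★ `sub_le_axial_of_test` — the tube test itself: `a − r ≤ τ_z` (the segment reaches `B̄(c, r)`);
* ★★ `le_axial_of_excl` — the carrier-side exclusion `b_c ≤ dist z c`: if `r² + κ²(a − r)² < b_c²` and `(α₀ − a)² + κ² α₀² ≤ b_c²` (`a − r ≤ α₀`) then
  `α₀ ≤ τ_z` (`dist z c² = (τ_z − a)² + radial² ≤ (τ_z − a)² + κ²τ_z²`, a convex quadratic in `τ_z`; for far sources this gives `α₀ ≈ a + √(b_c² − κ²a²)`,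
  cert64's axial start);
* ★ `add_le_dist_of_test` — the perpendicular-foot distance start `q₁ + q₂ ≤ dist y z` for rational `q₁² ≤ a² − r²`, `q₂² ≤ dist z c² − r²` (part 10).

Ingredients: the sharp shadow cone `radial_sq_le_of_shadow` (part 15), the class index `Nat.findGreatest (α · ≤ τ) K`, the frustum count
`card_mul_le_cone_of_subset_image` (part 15) per class with the weight `(max α_k d₀)⁻⁶`, and the closed-form CONE TAIL `cone_tail_sum_mul_le` (part 16)
beyond `α_K`.  Summing over source classes (Abel, part 11, with the cored-cap counts of part 14) and dividing by the block count (parts 5/12) is the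
remaining, purely arithmetical half.  0 sorry; standard axioms.
-/

noncomputable section

open scoped Classical RealInnerProductSpace
open Literature.MathematicalPhysics.StatisticalMechanics Literature.Geometry.DiscreteGeometry
open Summit.AtomisticToContinuum.Crystallization.Theses.PricedLinkCensus
open Summit.AtomisticToContinuum.Crystallization.Theorems.ChargedEnergyGapNegative

namespace Summit.AtomisticToContinuum.Crystallization.Theorems.ChargedEnergyGapChartDial

section SourceKernel

/-- An increasing sequence: `α 0 ≤ α k`. [formal bookkeeping] -/
theorem le_of_succ_le_nat {α : ℕ → ℝ} (hmono : ∀ k, α k ≤ α (k + 1)) (k : ℕ) : α 0 ≤ α k := by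
  induction k with
  | zero => exact le_rfl
  | succ n ih => exact ih.trans (hmono n)

/-- The START condition in usable form: `α₀² a² ≤ (a² − r²) b₀²`, `√(a² − r²)·d ≤ a·τ`, `b₀ ≤ d` ⟹ `α₀ ≤ τ` (`0 ≤ α₀`, `0 ≤ b₀`, `r < a`). -/
theorem start_le_axial {a r b₀ α₀ d τ : ℝ} (hr : 0 ≤ r) (hra : r < a) (hα : 0 ≤ α₀) (hb : 0 ≤ b₀) (hbd : b₀ ≤ d)
    (hstart : α₀ ^ 2 * a ^ 2 ≤ (a ^ 2 - r ^ 2) * b₀ ^ 2) (hτ : Real.sqrt (a ^ 2 - r ^ 2) * d ≤ a * τ) : α₀ ≤ τ := by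
  have ha : 0 < a := hr.trans_lt hra
  have hgap : 0 < a ^ 2 - r ^ 2 := by nlinarith [pow_lt_pow_left₀ hra hr two_ne_zero]
  set q := Real.sqrt (a ^ 2 - r ^ 2) with hq
  have hq0 : 0 < q := Real.sqrt_pos.2 hgap
  have hqq : q ^ 2 = a ^ 2 - r ^ 2 := Real.sq_sqrt hgap.le
  -- α₀ a ≤ q b₀ ≤ q d ≤ a τ
  have h1 : α₀ * a ≤ q * b₀ := by
    refine (pow_le_pow_iff_left₀ (by positivity) (by positivity) two_ne_zero).1 ?_
    rw [mul_pow, mul_pow, hqq]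
    exact hstart
  have h2 : q * b₀ ≤ q * d := mul_le_mul_of_nonneg_left hbd hq0.le
  have h3 : α₀ * a ≤ a * τ := h1.trans (h2.trans hτ)
  nlinarith

/-- With the axis `b 2 = (dist y c)⁻¹ • (c − y)`: `c − y = (dist y c) • b 2`, `⟪b 2, c − y⟫ = dist y c`, `⟪b 0, c − y⟫ = ⟪b 1, c − y⟫ = 0`. -/
theorem axis_frame {b : OrthonormalBasis (Fin 3) ℝ E3} {y c : E3} (hb : b 2 = (dist y c)⁻¹ • (c - y)) (hyc : y ≠ c) :
    c - y = dist y c • b 2 ∧ ⟪b 2, c - y⟫ = dist y c ∧ ⟪b 0, c - y⟫ = 0 ∧ ⟪b 1, c - y⟫ = 0 := by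
  have hd : 0 < dist y c := dist_pos.2 hyc
  have e : c - y = dist y c • b 2 := by rw [hb, smul_smul, mul_inv_cancel₀ hd.ne', one_smul]
  have hij := orthonormal_iff_ite.1 b.orthonormal
  refine ⟨e, ?_, ?_, ?_⟩
  · rw [e, real_inner_smul_right, hij]; simp
  · rw [e, real_inner_smul_right, hij]; simp
  · rw [e, real_inner_smul_right, hij]; simp

/-- ★ START from the tube test: `p ∈ [y, z]`, `dist p c ≤ r < a` ⟹ `a − r ≤ τ_z` (the axial coordinate of `p` is `≥ a − r`, and `τ_p = t·τ_z`, `t ≤ 1`). -/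
theorem sub_le_axial_of_test {b : OrthonormalBasis (Fin 3) ℝ E3} {c y z p : E3} {r : ℝ} (hb : b 2 = (dist y c)⁻¹ • (c - y))
    (hp : p ∈ segment ℝ y z) (hpc : dist p c ≤ r) (hry : r < dist y c) : dist y c - r ≤ ⟪b 2, z - y⟫ := by
  have hr : 0 ≤ r := dist_nonneg.trans hpc
  have ha : 0 < dist y c := hr.trans_lt hry
  have hyc : y ≠ c := fun h0 => by rw [h0, dist_self] at ha; exact lt_irrefl _ ha
  obtain ⟨-, h2, -, -⟩ := axis_frame hb hyc
  have hsh := (radial_sq_le_of_shadow hb hp hpc hry).2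
  have hτ0 : 0 ≤ ⟪b 2, z - y⟫ := by
    have hq : 0 < Real.sqrt (dist y c ^ 2 - r ^ 2) := Real.sqrt_pos.2 (by nlinarith [pow_lt_pow_left₀ hry hr two_ne_zero])
    have h0 : 0 ≤ Real.sqrt (dist y c ^ 2 - r ^ 2) * dist y z := mul_nonneg hq.le dist_nonneg
    nlinarith
  -- p = y + t (z - y)
  rw [segment_eq_image'] at hp
  obtain ⟨t, ⟨ht0, ht1⟩, rfl⟩ := hp
  have hτp : ⟪b 2, y + t • (z - y) - y⟫ = t * ⟪b 2, z - y⟫ := by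
    rw [add_sub_cancel_left, real_inner_smul_right]
  -- axial of p ≥ a - r
  have hpc' : dist y c - r ≤ ⟪b 2, y + t • (z - y) - y⟫ := by
    have e : y + t • (z - y) - y = (c - y) + (y + t • (z - y) - c) := by abel
    rw [e, inner_add_right, h2]
    have hle : |⟪b 2, y + t • (z - y) - c⟫| ≤ r := by
      calc |⟪b 2, y + t • (z - y) - c⟫| ≤ ‖b 2‖ * ‖y + t • (z - y) - c‖ := abs_real_inner_le_norm _ _
        _ = dist (y + t • (z - y)) c := by rw [b.orthonormal.1 2, one_mul, dist_eq_norm]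
        _ ≤ r := hpc
    have := (abs_le.1 hle).1
    linarith
  rw [hτp] at hpc'
  calc dist y c - r ≤ t * ⟪b 2, z - y⟫ := hpc'
    _ ≤ 1 * ⟪b 2, z - y⟫ := mul_le_mul_of_nonneg_right ht1 hτ0
    _ = ⟪b 2, z - y⟫ := one_mul _

/-- ★★ START from the carrier-side exclusion `b_c ≤ dist z c`: with a slope bound `κ` (`r² ≤ κ²(a² − r²)`), `a − r ≤ α₀`,
`r² + κ²(a − r)² < b_c²` and `(α₀ − a)² + κ² α₀² ≤ b_c²` ⟹ `α₀ ≤ τ_z` for every target seen through the tube. -/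
theorem le_axial_of_excl {b : OrthonormalBasis (Fin 3) ℝ E3} {c y z p : E3} {r κ b_c α₀ : ℝ} (hb : b 2 = (dist y c)⁻¹ • (c - y))
    (hp : p ∈ segment ℝ y z) (hpc : dist p c ≤ r) (hry : r < dist y c) (hκr : r ^ 2 ≤ κ ^ 2 * (dist y c ^ 2 - r ^ 2))
    (hbc : 0 ≤ b_c) (hzc : b_c ≤ dist z c) (hα : dist y c - r ≤ α₀) (h1 : r ^ 2 + κ ^ 2 * (dist y c - r) ^ 2 < b_c ^ 2)
    (h2 : (α₀ - dist y c) ^ 2 + κ ^ 2 * α₀ ^ 2 ≤ b_c ^ 2) : α₀ ≤ ⟪b 2, z - y⟫ := by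
  have hr : 0 ≤ r := dist_nonneg.trans hpc
  have ha : 0 < dist y c := hr.trans_lt hry
  have hyc : y ≠ c := fun h0 => by rw [h0, dist_self] at ha; exact lt_irrefl _ ha
  have hgap : 0 < dist y c ^ 2 - r ^ 2 := by nlinarith [pow_lt_pow_left₀ hry hr two_ne_zero]
  obtain ⟨-, h2ax, h0ax, h1ax⟩ := axis_frame hb hyc
  have hsh := radial_sq_le_of_shadow hb hp hpc hry
  have hL := sub_le_axial_of_test hb hp hpc hry
  set τ := ⟪b 2, z - y⟫ with hτ
  -- radial² ≤ κ² τ²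
  have hrad : ⟪b 0, z - y⟫ ^ 2 + ⟪b 1, z - y⟫ ^ 2 ≤ κ ^ 2 * τ ^ 2 := by
    refine hsh.1.trans ?_
    rw [mul_pow, div_pow, Real.sq_sqrt hgap.le]
    refine mul_le_mul_of_nonneg_right ?_ (sq_nonneg _)
    rwa [div_le_iff₀ hgap]
  -- dist z c² = radial² + (τ - a)²
  have hzc2 : dist z c ^ 2 = ⟪b 0, z - y⟫ ^ 2 + ⟪b 1, z - y⟫ ^ 2 + (τ - dist y c) ^ 2 := by
    have e : z - c = (z - y) - (c - y) := by abel
    have hi0 : ⟪b 0, z - c⟫ = ⟪b 0, z - y⟫ := by rw [e, inner_sub_right (b 0) (z - y) (c - y), h0ax, sub_zero]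
    have hi1 : ⟪b 1, z - c⟫ = ⟪b 1, z - y⟫ := by rw [e, inner_sub_right (b 1) (z - y) (c - y), h1ax, sub_zero]
    have hi2 : ⟪b 2, z - c⟫ = τ - dist y c := by rw [e, inner_sub_right (b 2) (z - y) (c - y), h2ax]
    have hpar := inner_sq_add_inner_sq_eq b (z - c)
    rw [hi0, hi1, hi2, ← dist_eq_norm] at hpar
    linarith
  have hf : b_c ^ 2 ≤ (τ - dist y c) ^ 2 + κ ^ 2 * τ ^ 2 := by
    have hbc2 : b_c ^ 2 ≤ dist z c ^ 2 := pow_le_pow_left₀ hbc hzc 2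
    nlinarith
  rcases le_or_gt α₀ τ with hok | hlt
  · exact hok
  exfalso
  -- the chord inequality of the convex quadratic f(τ) = (τ - a)² + κ²τ² on [a - r, α₀)
  have hid : (α₀ - (dist y c - r)) * ((τ - dist y c) ^ 2 + κ ^ 2 * τ ^ 2) =
      (α₀ - τ) * (r ^ 2 + κ ^ 2 * (dist y c - r) ^ 2) + (τ - (dist y c - r)) * ((α₀ - dist y c) ^ 2 + κ ^ 2 * α₀ ^ 2) +
        (1 + κ ^ 2) * (τ - (dist y c - r)) * (τ - α₀) * (α₀ - (dist y c - r)) := by ring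
  nlinarith [mul_pos (sub_pos.2 hlt) (sub_pos.2 h1), mul_nonneg (sub_nonneg.2 hL) (sub_nonneg.2 h2),
    mul_nonneg (mul_nonneg (sub_nonneg.2 hL) (sub_pos.2 hlt).le) (sub_nonneg.2 (hL.trans hlt.le)), sq_nonneg κ,
    mul_nonneg (mul_nonneg (mul_nonneg (sub_nonneg.2 hL) (sub_pos.2 hlt).le) (sub_nonneg.2 (hL.trans hlt.le))) (sq_nonneg κ)]

/-- ★ The perpendicular-foot DISTANCE START (part 10) in rational form: a target seen through the tube with `r < dist z c` satisfies
`q₁ + q₂ ≤ dist y z` whenever `q₁² ≤ a² − r²`, `q₂² ≤ dist z c² − r²`. -/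
theorem add_le_dist_of_test {c y z : E3} {r q₁ q₂ : ℝ} (h : Metric.infDist c (segment ℝ y z) ≤ r) (hry : r < dist y c) (hrz : r < dist z c)
    (hq₁' : q₁ ^ 2 ≤ dist y c ^ 2 - r ^ 2) (hq₂' : q₂ ^ 2 ≤ dist z c ^ 2 - r ^ 2) : q₁ + q₂ ≤ dist y z := by
  have hle := sqrt_add_sqrt_le_dist_of_infDist_le h hry hrz
  have e1 : q₁ ≤ Real.sqrt (dist y c ^ 2 - r ^ 2) := Real.le_sqrt_of_sq_le hq₁'
  have e2 : q₂ ≤ Real.sqrt (dist z c ^ 2 - r ^ 2) := Real.le_sqrt_of_sq_le hq₂'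
  linarith

/-- ★★ The PER-SOURCE KERNEL of the tube regime (see the module docstring). -/
theorem source_kernel_mul_le {a h : ℝ} {s : ℤ → ℤ} {g : E3 → E3}
    (ha : 9 / 10 ≤ a ∧ a ≤ 11 / 10) (hh : 0 < h ∧ 27 / 50 * a ^ 2 ≤ h ^ 2 ∧ h ^ 2 ≤ 121 / 150 * a ^ 2) (hg : Isometry g)
    {b : OrthonormalBasis (Fin 3) ℝ E3} {y c : E3} {r d₀ κ : ℝ} (hb : b 2 = (dist y c)⁻¹ • (c - y))
    (hr : 0 ≤ r) (hry : r < dist y c) (hκ : 0 ≤ κ) (hκr : r ^ 2 ≤ κ ^ 2 * (dist y c ^ 2 - r ^ 2))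
    (α : ℕ → ℝ) (K : ℕ) (hmono : ∀ k, α k ≤ α (k + 1)) (hα0 : 0 < α 0) (hαK : 18 / 5 ≤ α K)
    (T : Finset E3) (hT : ↑T ⊆ g '' barlowStacking a h s)
    (hstart : ∀ z ∈ T, y ≠ z → Metric.infDist c (segment ℝ y z) ≤ r → α 0 ≤ ⟪b 2, z - y⟫)
    (hTy : ∀ z ∈ T, y ≠ z → Metric.infDist c (segment ℝ y z) ≤ r → d₀ ≤ dist y z) :
    (∑ z ∈ T, if y ≠ z ∧ Metric.infDist c (segment ℝ y z) ≤ r then (dist y z)⁻¹ ^ 6 else 0) * (a * (a * √3 / 2) * h) ≤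
      ∑ k ∈ Finset.range K, coneVol κ ((κ + 1) * (9 / 5)) (α k - 9 / 5) (α (k + 1) + 9 / 5) * (max (α k) d₀)⁻¹ ^ 6 +
        (128 * Real.pi / 7 * κ ^ 2 / α K ^ 3 + 128 * Real.pi / 31 * ((2 * κ + 1) * (9 / 5)) ^ 2 / α K ^ 5) := by
  have ha0 : 0 ≤ a := by linarith [ha.1]
  have hV0 : 0 ≤ a * (a * √3 / 2) * h := by have := hh.1.le; positivity
  set A := dist y c with hA
  have hApos : 0 < A := hr.trans_lt hry
  have hgap : 0 < A ^ 2 - r ^ 2 := by nlinarith [pow_lt_pow_left₀ hry hr two_ne_zero]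
  -- the test-true targets and their geometry
  set T' := T.filter (fun z => y ≠ z ∧ Metric.infDist c (segment ℝ y z) ≤ r) with hT'
  have hsumT' : (∑ z ∈ T, if y ≠ z ∧ Metric.infDist c (segment ℝ y z) ≤ r then (dist y z)⁻¹ ^ 6 else 0) =
      ∑ z ∈ T', (dist y z)⁻¹ ^ 6 := by
    rw [hT', Finset.sum_filter]
  have hT'sub : T' ⊆ T := Finset.filter_subset _ _
  -- geometry of a test-true target: axial `τ z := ⟪b 2, z - y⟫ ≥ α 0`, `τ ≤ dist`, cone with slope `κ`
  have hgeo : ∀ z ∈ T', α 0 ≤ ⟪b 2, z - y⟫ ∧ ⟪b 2, z - y⟫ ≤ dist y z ∧ d₀ ≤ dist y z ∧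
      ⟪b 0, z - y⟫ ^ 2 + ⟪b 1, z - y⟫ ^ 2 ≤ (κ * ⟪b 2, z - y⟫) ^ 2 := by
    intro z hz
    rw [hT', Finset.mem_filter] at hz
    obtain ⟨hzT, hne, hinf⟩ := hz
    obtain ⟨p, hp, hpc⟩ := exists_mem_segment_dist_le hinf
    have hsh := radial_sq_le_of_shadow hb hp hpc hry
    refine ⟨hstart z hzT hne hinf, inner_axis_le_dist b y z, hTy z hzT hne hinf, hsh.1.trans ?_⟩
    rw [mul_pow, mul_pow, div_pow, Real.sq_sqrt hgap.le]
    refine mul_le_mul_of_nonneg_right ?_ (sq_nonneg _)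
    rwa [div_le_iff₀ hgap]
  -- class index
  set cls : E3 → ℕ := fun z => Nat.findGreatest (fun k => α k ≤ ⟪b 2, z - y⟫) K with hcls
  have hcls_le : ∀ z, cls z ≤ K := fun z => Nat.findGreatest_le K
  have hcls_spec : ∀ z ∈ T', α (cls z) ≤ ⟪b 2, z - y⟫ := fun z hz =>
    Nat.findGreatest_spec (P := fun k => α k ≤ ⟪b 2, z - y⟫) (Nat.zero_le K) (hgeo z hz).1
  have hcls_lt : ∀ z ∈ T', cls z < K → ⟪b 2, z - y⟫ < α (cls z + 1) := fun z _ hlt =>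
    lt_of_not_ge (Nat.findGreatest_is_greatest (P := fun k => α k ≤ ⟪b 2, z - y⟫) (Nat.lt_succ_self _) hlt)
  -- fiberwise decomposition
  have hfib : ∑ z ∈ T', (dist y z)⁻¹ ^ 6 = ∑ k ∈ Finset.range (K + 1), ∑ z ∈ T' with cls z = k, (dist y z)⁻¹ ^ 6 := by
    rw [Finset.sum_fiberwise_of_maps_to]
    intro z _
    exact Finset.mem_range.2 (Nat.lt_succ_of_le (hcls_le z))
  -- per class `k < K`
  have hclass : ∀ k ∈ Finset.range K, (∑ z ∈ T' with cls z = k, (dist y z)⁻¹ ^ 6) * (a * (a * √3 / 2) * h) ≤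
      coneVol κ ((κ + 1) * (9 / 5)) (α k - 9 / 5) (α (k + 1) + 9 / 5) * (max (α k) d₀)⁻¹ ^ 6 := by
    intro k hk
    have hkK : k < K := Finset.mem_range.1 hk
    have hαk : 0 < α k := hα0.trans_le (le_of_succ_le_nat hmono k)
    have hm0 : 0 < max (α k) d₀ := lt_max_of_lt_left hαk
    set Tk := T'.filter (fun z => cls z = k) with hTk
    -- weight
    have hw : ∀ z ∈ Tk, (dist y z)⁻¹ ^ 6 ≤ (max (α k) d₀)⁻¹ ^ 6 := by
      intro z hz
      rw [hTk, Finset.mem_filter] at hz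
      obtain ⟨hzT', hzk⟩ := hz
      have hg' := hgeo z hzT'
      have hsp := hcls_spec z hzT'
      rw [hzk] at hsp
      have hdz : max (α k) d₀ ≤ dist y z := max_le (hsp.trans hg'.2.1) hg'.2.2.1
      exact pow_le_pow_left₀ (inv_nonneg.2 (hm0.le.trans hdz)) (inv_anti₀ hm0 hdz) 6
    have h1 : ∑ z ∈ Tk, (dist y z)⁻¹ ^ 6 ≤ Tk.card * (max (α k) d₀)⁻¹ ^ 6 := by
      rw [← nsmul_eq_mul, ← Finset.sum_const]
      exact Finset.sum_le_sum hw
    -- count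
    have hsub : (↑Tk : Set E3) ⊆ g '' barlowStacking a h s ∩ orthoCone b y (α k) (α (k + 1)) κ 0 := by
      intro z hz
      have hz' : z ∈ Tk := by exact_mod_cast hz
      rw [hTk, Finset.mem_filter] at hz'
      obtain ⟨hzT', hzk⟩ := hz'
      refine ⟨hT (hT'sub hzT'), ?_⟩
      rw [mem_orthoCone_iff]
      have hg' := hgeo z hzT'
      have hsp := hcls_spec z hzT'
      have hlt := hcls_lt z hzT' (hzk ▸ hkK)
      rw [hzk] at hsp hlt
      refine ⟨hsp, hlt.le, ?_⟩
      rw [add_zero]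
      exact hg'.2.2.2
    have h2 := card_mul_le_cone_of_subset_image ha hh hg b y hκ (by rw [add_zero]; exact mul_nonneg hκ hαk.le) (hmono k) Tk hsub
    rw [zero_add] at h2
    calc (∑ z ∈ Tk, (dist y z)⁻¹ ^ 6) * (a * (a * √3 / 2) * h)
        ≤ (Tk.card * (max (α k) d₀)⁻¹ ^ 6) * (a * (a * √3 / 2) * h) := mul_le_mul_of_nonneg_right h1 hV0
      _ = (Tk.card * (a * (a * √3 / 2) * h)) * (max (α k) d₀)⁻¹ ^ 6 := by ring
      _ ≤ coneVol κ ((κ + 1) * (9 / 5)) (α k - 9 / 5) (α (k + 1) + 9 / 5) * (max (α k) d₀)⁻¹ ^ 6 :=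
          mul_le_mul_of_nonneg_right h2 (by positivity)
  -- the tail class `k = K`
  have htail : (∑ z ∈ T' with cls z = K, (dist y z)⁻¹ ^ 6) * (a * (a * √3 / 2) * h) ≤
      128 * Real.pi / 7 * κ ^ 2 / α K ^ 3 + 128 * Real.pi / 31 * ((2 * κ + 1) * (9 / 5)) ^ 2 / α K ^ 5 := by
    refine cone_tail_sum_mul_le (s := s) ha hh hg b y hκ hαK _ ?_ ?_
    · intro z hz
      have hz' : z ∈ T'.filter (fun z => cls z = K) := by exact_mod_cast hz
      exact hT (hT'sub (Finset.mem_filter.1 hz').1)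
    · intro z hz
      obtain ⟨hzT', hzk⟩ := Finset.mem_filter.1 hz
      have hsp := hcls_spec z hzT'
      rw [hzk] at hsp
      exact ⟨hsp, (hgeo z hzT').2.2.2⟩
  -- assemble
  rw [hsumT', hfib, Finset.sum_range_succ, add_mul, Finset.sum_mul]
  exact add_le_add (Finset.sum_le_sum hclass) htail

end SourceKernel

end Summit.AtomisticToContinuum.Crystallization.Theorems.ChargedEnergyGapChartDial

end
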